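import Literature.MathematicalPhysics.QuantumFieldTheory.Balaban1983to89.Node00.N24KnitStage12CarriersAll
import Literature.MathematicalPhysics.QuantumFieldTheory.Balaban1983to89.B16RLeafRecord12AtLive

/-!
# NODE N24 · THE CLOSER'S FOUR-PIN POINTED FORM ON THE K0′ WITNESS LINE — at a live re-pin `θ.liveRepin` (node00-def-K0a) and at `θ₀ˡⁱᵛᵉ = theta12LiveOfRecord F N ζ₀ Rz Zt`:
# module 33's `N24_stabilityBR12e_thetaShape15_fourPin_pointed_all` (N08 ← THE PRINTED `PrintedUV3V N θ.L`, N06 ∕ N07 ∕ N12 at CHOSEN layers, N09 ∕ N11 ∕ N13 by name) with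
# N13's (R₁₂), `Admissible` and the guard's `SlotsNondegenerate` DISCHARGED BY NAME (seat dag-n11-e's `B16RLeafRecord12AtLive` + node00-def-K0a's `Record12LiveSelector(Torus)`)

TRACK A (YM-PLAN §2d, node N24 of 28 = binder B2 `hB : B16.EndStatementBPrinted D.C`), seat `pub-ymgap-dag-n24-c` (R134 fan-out seat, strategy s2; gen 3).  THIRTY-FIFTH N24 module,
a NEW importing one (modules 1–34 untouched; imports module 33 `N24KnitStage12CarriersAll` and `B16RLeafRecord12AtLive`); the four-pin companion of module 34
`N24NodesStage12PointedAtLive` (bare view).  THEOREMS ONLY, def-free, sorry-free, standard axioms.  Everything BY NAME: module 33's theorem; K0a's `Stage12Params.liveRepin`,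
`Admissible.liveRepin`, `ZtUnity.liveRepin`, `slotsNondegenerate_liveRepin` (from `Provisos₁₀` of the re-pin = `hP.base`), `theta12LiveOfRecord = (theta12OfRecord …).liveRepin`
(`rfl`), `admissible_theta12OfRecord`; dag-n11-e's `rOpLeaf_VOfRecord₁₂_liveRepin_signFree` (the 𝐑-leaf of record at a live re-pin from the provisos at the re-pin,
admissibility and the term-constant signs; `0 ≤ g_{k+1}` free), `kappa∕E0∕B0_nonneg_theta12OfRecord`; def-T's `rOpLeaf_VOfRecord₁₂_iff`.  At the four-pin view the world's
𝐑-leaf is STILL θ's repaired R-law (module 29's `N24_rOperation_iff_of_up_view₁₂B10YZW`), so the leaf at `θ.liveRepin` feeds module 33's `hR` unchanged.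

WHAT THIS FILE PROVES.
§1 `N24_stabilityBR12e_thetaShape15_fourPin_pointed_all_liveRepin` — K1′'s rev-15 consequent witnessed by `(θ.liveRepin, hP)` over the four-pin view at chosen layers
   `(M⋆, ops, ζ, λW)`: displayed — `hP` (provisos at the re-pin), `hZ : θ.ZtUnity`, `θ`'s signs, the world binding to the view, N05's [B8] residual leaf at `θ.liveRepin.res.X`
   (= `θ.res.X`), N06 `B9LeafX (Y9OfRecord N θ₃ M⋆ ops)`, N07 `B11Leaf (Z11OfRecord F N ζ)`, N08 `PrintedUV3V N θ.L`, N09 own leaf + [B11] Thm 1 ×3, N10's B13 socket at the view,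
   N11 (S1ᵀ), N12 `B15Leaf (WOfRecord₁₂ (θ.liveRepin) λW P)`, N13 (UV₁₂) only, the β-box pair.
§2 **`N24_stabilityBR12e_thetaShape15_fourPin_pointed_all_theta12Live`** — the same at `θ₀ˡⁱᵛᵉ` (every `(ζ₀, Rz, Zt)`; admissibility and signs theorems): WHICH CHILD BLOCKS ON
   THE K0′ WITNESS LINE OVER THE FOUR-PIN VIEW = its hypothesis list — `hP` (= K0′'s residual at the witness) · `hZ` · world binding · N05 [B8] residual leaf · N06 ∕ N07 ∕ N12 at
   CHOSEN layers · N08 PRINTED `PrintedUV3V N θ₀ˡⁱᵛᵉ.L` · N09 own leaf + [B11] Thm 1 ×3 · N10 socket · N11 (S1ᵀ) · N13 (UV₁₂) · β⁺ ([I] (1.22) p. 264) + `b > 0` (NODE O, UNPRINTED).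
HONEST SCOPE: on the live-re-pin branch 𝐑 of record = identity a.e. (dag-n11-e) — [Balaban1989LargeFieldII] Thm 1's 𝐑-construction NOT exercised, N13 NOT discharged; no corollary at
K0b's uniform residuals of record (dag-n11-d's READING, pub-ymgap INBOX l.14524, expects (S1ᵀ) to fail there).  Kernel bookkeeping BY NAME; nothing of Bałaban's asserted; every slot
DISPLAYED; N24 COMPOSITE — no discharge, no count, no stub closed; one finite T⁴ programme at fixed ε; NOT continuum ∕ ℝ⁴ ∕ OS ∕ mass gap ∕ Clay.
-/

noncomputable section

open scoped Matrix.Norms.L2Operator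

namespace Literature.MathematicalPhysics.QuantumFieldTheory.Balaban1983to89.Node00

open DagBinding T4Continuum T4DatumAssembly FlowStepRuns AveragingRT
open FlowStep (BetaLowerH BetaUpperH)
open B16RLeafRecord12AtLive (rOpLeaf_VOfRecord₁₂_liveRepin_signFree kappa_nonneg_theta12OfRecord E0_nonneg_theta12OfRecord B0_nonneg_theta12OfRecord)

variable {F : T4Family} {N : ℕ} [NeZero N]

/-! ## §1. At any live re-pin `θ.liveRepin`, over the four-pin view at chosen layers -/

/-- **THE CONSEQUENT OF ITEM K1′ `StabilityBAtRecordR12e` (rev 15, stmt-QuantumFields-19903) OVER THE FOUR-PIN VIEW, WITNESSED BY A LIVE RE-PIN `(θ.liveRepin, hP)`** —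
module 33's `N24_stabilityBR12e_thetaShape15_fourPin_pointed_all` at `θ.liveRepin` with N13's (R₁₂) (`rOpLeaf_VOfRecord₁₂_liveRepin_signFree` via `rOpLeaf_VOfRecord₁₂_iff`),
`Admissible` (`Admissible.liveRepin`) and the guard's `SlotsNondegenerate` (`slotsNondegenerate_liveRepin` from `hP.base`) DISCHARGED BY NAME; N08 ← THE PRINTED SENTENCE
`PrintedUV3V N θ.L`; N06 ∕ N07 ∕ N12 at the chosen layers `(M⋆, ops)`, `ζ`, `λW`.  COMPOSITE: nothing is discharged as a node.
[cite: Balaban1989LargeFieldII, Thm 1 p.355 (𝐑-construction not exercised), (0.1) pp.355–356, p.391; Balaban1985UV3, (1)–(5) p.256, Thm 1 p.257 + Thm 2 p.272; Balaban1988Convergent, p.244, Thm 2 p.263, (3.16)–(3.22) pp.268–269, (3.24) p.270; Balaban1989LargeFieldI, (0.3) p.176, p.177 (i)–(ii); Balaban1987RG1, Thm 3 p.264, (0.17)–(0.21) pp.255–256 and (1.22) p.264; Balaban1985Variational, Thm 1 p.279 (bookkeeping + elementary window)] -/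
theorem N24_stabilityBR12e_thetaShape15_fourPin_pointed_all_liveRepin (θ : Stage12Params F N) (hP : (θ.liveRepin F N).Provisos₁₂ F N)
    (hθ : θ.Admissible F N) (hZ : θ.ZtUnity F N) (hκ : 0 ≤ θ.s2.lf.κ) (hE₀ : 0 ≤ θ.s2.lf.E₀) (hB₀ : 0 ≤ θ.s2.lf.B₀)
    (Mstar : ℕ) (ops : OpsY N (θ.liveRepin F N).toStage3Params Mstar) (ζ : ResidZ F N) (lamW : ResidW F N) (w : WorldP)
    (hC : w.C = (datumOfRecord₁₂ F N (θ.liveRepin F N) hP).C) (hγ : 0 < w.γ ∧ w.γ ≤ (θ.liveRepin F N).γ) (hL : w.L = ((θ.liveRepin F N).L : ℝ))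
    (hup : ∀ P, w.up P = upOfRecord₅C F N ((θ.liveRepin F N).view₁₂B10YZW F N Mstar ops ζ lamW) P)
    (h05 : ∀ P : B12.RunParams,
      B8LeafR ((θ.liveRepin F N).res.X P).d8 ((θ.liveRepin F N).res.X P).L8 ((θ.liveRepin F N).res.X P).C₂ ((θ.liveRepin F N).res.X P).B₁' ((θ.liveRepin F N).res.X P).B₀' ((θ.liveRepin F N).res.X P).B₁ ((θ.liveRepin F N).res.X P).B₂ ((θ.liveRepin F N).res.X P).c₁
        ((θ.liveRepin F N).res.X P).inp8 ((θ.liveRepin F N).res.X P).B₀β ((θ.liveRepin F N).res.X P).loc8 ((θ.liveRepin F N).res.X P).fam8R ((θ.liveRepin F N).res.X P).lan8 ((θ.liveRepin F N).res.X P).cub8 ((θ.liveRepin F N).res.X P).toAxial8)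
    (h06 : B9LeafX (Y9OfRecord N (θ.liveRepin F N).toStage3Params Mstar ops))
    (h07 : B11Leaf (Z11OfRecord F N ζ))
    (h08 : PrintedUV3V N (θ.liveRepin F N).L)
    (h09 : ∀ P : B12.RunParams, B12Sec2to5.Lemma4Printed ((θ.liveRepin F N).res.X P).F12 ((θ.liveRepin F N).res.X P).c12)
    (h11dom : ∀ (P : B12.RunParams) (k : ℕ), k ≤ P.K →
      ∀ V ∈ domAltOfRecord F N (θ.liveRepin F N).ν P.K k, UkExists F N P.K k (θ.liveRepin F N).εbg V ∧ UniqueUkOrbit F N P.K k (θ.liveRepin F N).εbg V)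
    (hres : ∀ (P : B12.RunParams) (k : ℕ), k ≤ P.K → HRestrict F N (θ.liveRepin F N).εbg P.K k (domAltOfRecord F N (θ.liveRepin F N).ν P.K k))
    (huniq : ∀ (P : B12.RunParams) (k : ℕ), k ≤ P.K → ∀ V ∈ domAltOfRecord F N (θ.liveRepin F N).ν P.K k, ∀ j < k,
      UniqueUkOrbit F N P.K (j + 1) (θ.liveRepin F N).εbg (Averaging.iter (avOfRecord F N P.K) (j + 1) (Uk F N P.K k (θ.liveRepin F N).εbg V)))
    (h10 : ∀ P : B12.RunParams, B9LeafX (Y9OfRecord N (θ.liveRepin F N).toStage3Params Mstar ops) →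
      (B10.Thm1PrintedCompact (((θ.liveRepin F N).view₁₂B10YZW F N Mstar ops ζ lamW).res.X P).runs10 ∧
          B10.Thm2Printed (((θ.liveRepin F N).view₁₂B10YZW F N Mstar ops ζ lamW).res.X P).runs10) →
        B11Leaf (Z11OfRecord F N ζ) → B12Sec2to5.Lemma4Printed ((θ.liveRepin F N).res.X P).F12 ((θ.liveRepin F N).res.X P).c12 →
          B13.Lemma1Printed ((θ.liveRepin F N).res.X P).S13 ((θ.liveRepin F N).res.X P).c13 ∧ B13.Lemma2Printed ((θ.liveRepin F N).res.X P).S13 ((θ.liveRepin F N).res.X P).c13 ∧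
            B13.Lemma3Printed ((θ.liveRepin F N).res.X P).S13 ((θ.liveRepin F N).res.X P).c13)
    (h11 : ∀ P : B12.RunParams, (leavesP w P).b7 → (leavesP w P).b8 → (leavesP w P).b9 → (leavesP w P).b10 → (leavesP w P).b11 →
      (leavesP w P).smallCouplings → (leavesP w P).smallFieldInductive → (leavesP w P).flowControl →
        ∀ k, k < P.K → SLaw₁₂ F N (θ.liveRepin F N) P k → TLaw₁₂ F N (θ.liveRepin F N) P k)
    (h12 : ∀ P : B12.RunParams, B15Leaf (WOfRecord₁₂ F N (θ.liveRepin F N) lamW P))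
    (hUV : ∀ P : B12.RunParams, (genFlow (betaOfRecord₁₀ F N (θ.liveRepin F N).toStage9Params) P.g0).InInterval w.γ P.K → ∀ k, k ≤ P.K → SLaw₁₂ F N (θ.liveRepin F N) P k →
      ∀ U : GaugeField (F.P P.K) k (SU N),
        chiFixed7 F N (θ.liveRepin F N).ν P.K (gOfRecord₁₀ F N (θ.liveRepin F N).toStage9Params P) k U *
              Real.exp (-(1 / (gOfRecord₁₀ F N (θ.liveRepin F N).toStage9Params P k) ^ 2 * wilsonBGOfRecord F N (θ.liveRepin F N).εbg P k U)
                - w.em (gOfRecord₁₀ F N (θ.liveRepin F N).toStage9Params P k) * (Fintype.card (Site (F.P P.K) k) : ℝ)) ≤ densOfRecord₁₀ F N (θ.liveRepin F N).toStage9Params P k U ∧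
        densOfRecord₁₀ F N (θ.liveRepin F N).toStage9Params P k U ≤ Real.exp (w.ep (gOfRecord₁₀ F N (θ.liveRepin F N).toStage9Params P k) * (Fintype.card (Site (F.P P.K) k) : ℝ)))
    (hlo : BetaLowerH w.b w.γ (datumOfRecord₁₂ F N (θ.liveRepin F N) hP).βfun) (hhi : BetaUpperH w.βup w.γ (datumOfRecord₁₂ F N (θ.liveRepin F N) hP).βfun) :
    ∃ (θ' : Stage12Params F N) (h' : θ'.Provisos₁₂ F N), (θ'.ZtUnity F N ∧ θ'.SlotsNondegenerate) ∧ θ'.Admissible F N ∧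
      B16.EndStatementBPrinted (datumOfRecord₁₂ F N θ' h').C ∧
      ∃ γ₁ : ℝ, 0 < γ₁ ∧ ∀ γ : ℝ, 0 < γ → γ ≤ γ₁ → ∃ P : B12.RunParams, 1 ≤ P.K ∧ ((datumOfRecord₁₂ F N θ' h').C P).flow.InInterval γ P.K :=
  N24_stabilityBR12e_thetaShape15_fourPin_pointed_all (θ.liveRepin F N) hP hθ.liveRepin
    ⟨hZ.liveRepin, Stage12Params.slotsNondegenerate_liveRepin F N θ hP.base⟩ Mstar ops ζ lamW w hC hγ hL hup h05 h06 h07 h08 h09 h11dom hres huniq h10 h11 h12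
    (fun P k hk => (rOpLeaf_VOfRecord₁₂_iff F N (θ.liveRepin F N) P).1 (rOpLeaf_VOfRecord₁₂_liveRepin_signFree F N θ P hP hθ hκ hE₀ hB₀) k hk) hUV hlo hhi

/-! ## §2. At the re-pinned K0′ witness `θ₀ˡⁱᵛᵉ = theta12LiveOfRecord F N ζ₀ Rz Zt`, over the four-pin view at chosen layers -/

section Theta

variable (ζ₀ : ZetaOfRecord F N numerics7OfRecord₁₂ 1) (Rz : (K : ℕ) → Sect2.Residual (F.P K) (MatA N)) (Zt : (K : ℕ) → TkResidualW F N (FluctV N) K)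

/-- **★ THE CONSEQUENT OF ITEM K1′ `StabilityBAtRecordR12e` OVER THE FOUR-PIN VIEW, WITNESSED BY `(θ₀ˡⁱᵛᵉ, hP)`** (§1 at `θ := theta12OfRecord F N ζ₀ Rz Zt`; admissibility
`admissible_theta12OfRecord`, signs `kappa∕E0∕B0_nonneg_theta12OfRecord`): WHICH CHILD BLOCKS ON THE K0′ WITNESS LINE OVER THE FOUR-PIN VIEW = this hypothesis list — `hP`
(= K0′'s residual at the witness), `hZ : ZtUnity` (a theorem at K0b's residuals of record), the world binding to the view, N05's [B8] residual leaf at `θ₀ˡⁱᵛᵉ.res.X`, N06 ∕ N07 ∕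
N12 at the CHOSEN layers, N08 THE PRINTED `PrintedUV3V N θ₀ˡⁱᵛᵉ.L`, N09's own leaf + [B11] Thm 1 ×3, N10's socket at the view, N11's (S1ᵀ), N13's (UV₁₂), the β-box pair.
COMPOSITE: nothing is discharged as a node. [cite: Balaban1989LargeFieldII, Thm 1 p.355, (0.1) pp.355–356, p.391; Balaban1985UV3, (1)–(5) p.256, Thm 1 p.257 + Thm 2 p.272; Balaban1988Convergent, p.244, Thm 2 p.263, (3.16)–(3.22) pp.268–269; Balaban1989LargeFieldI, (0.3)–(0.4) p.176; Balaban1987RG1, Thm 3 p.264, (0.17)–(0.21) pp.255–256 and (1.22) p.264; Balaban1985Variational, Thm 1 p.279 (bookkeeping + elementary window)] -/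
theorem N24_stabilityBR12e_thetaShape15_fourPin_pointed_all_theta12Live (hP : (theta12LiveOfRecord F N ζ₀ Rz Zt).Provisos₁₂ F N)
    (hZ : (theta12LiveOfRecord F N ζ₀ Rz Zt).ZtUnity F N)
    (Mstar : ℕ) (ops : OpsY N (theta12LiveOfRecord F N ζ₀ Rz Zt).toStage3Params Mstar) (ζ : ResidZ F N) (lamW : ResidW F N) (w : WorldP)
    (hC : w.C = (datumOfRecord₁₂ F N (theta12LiveOfRecord F N ζ₀ Rz Zt) hP).C) (hγ : 0 < w.γ ∧ w.γ ≤ (theta12LiveOfRecord F N ζ₀ Rz Zt).γ) (hL : w.L = ((theta12LiveOfRecord F N ζ₀ Rz Zt).L : ℝ))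
    (hup : ∀ P, w.up P = upOfRecord₅C F N ((theta12LiveOfRecord F N ζ₀ Rz Zt).view₁₂B10YZW F N Mstar ops ζ lamW) P)
    (h05 : ∀ P : B12.RunParams,
      B8LeafR ((theta12LiveOfRecord F N ζ₀ Rz Zt).res.X P).d8 ((theta12LiveOfRecord F N ζ₀ Rz Zt).res.X P).L8 ((theta12LiveOfRecord F N ζ₀ Rz Zt).res.X P).C₂ ((theta12LiveOfRecord F N ζ₀ Rz Zt).res.X P).B₁' ((theta12LiveOfRecord F N ζ₀ Rz Zt).res.X P).B₀' ((theta12LiveOfRecord F N ζ₀ Rz Zt).res.X P).B₁ ((theta12LiveOfRecord F N ζ₀ Rz Zt).res.X P).B₂ ((theta12LiveOfRecord F N ζ₀ Rz Zt).res.X P).c₁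
        ((theta12LiveOfRecord F N ζ₀ Rz Zt).res.X P).inp8 ((theta12LiveOfRecord F N ζ₀ Rz Zt).res.X P).B₀β ((theta12LiveOfRecord F N ζ₀ Rz Zt).res.X P).loc8 ((theta12LiveOfRecord F N ζ₀ Rz Zt).res.X P).fam8R ((theta12LiveOfRecord F N ζ₀ Rz Zt).res.X P).lan8 ((theta12LiveOfRecord F N ζ₀ Rz Zt).res.X P).cub8 ((theta12LiveOfRecord F N ζ₀ Rz Zt).res.X P).toAxial8)
    (h06 : B9LeafX (Y9OfRecord N (theta12LiveOfRecord F N ζ₀ Rz Zt).toStage3Params Mstar ops))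
    (h07 : B11Leaf (Z11OfRecord F N ζ))
    (h08 : PrintedUV3V N (theta12LiveOfRecord F N ζ₀ Rz Zt).L)
    (h09 : ∀ P : B12.RunParams, B12Sec2to5.Lemma4Printed ((theta12LiveOfRecord F N ζ₀ Rz Zt).res.X P).F12 ((theta12LiveOfRecord F N ζ₀ Rz Zt).res.X P).c12)
    (h11dom : ∀ (P : B12.RunParams) (k : ℕ), k ≤ P.K →
      ∀ V ∈ domAltOfRecord F N (theta12LiveOfRecord F N ζ₀ Rz Zt).ν P.K k, UkExists F N P.K k (theta12LiveOfRecord F N ζ₀ Rz Zt).εbg V ∧ UniqueUkOrbit F N P.K k (theta12LiveOfRecord F N ζ₀ Rz Zt).εbg V)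
    (hres : ∀ (P : B12.RunParams) (k : ℕ), k ≤ P.K → HRestrict F N (theta12LiveOfRecord F N ζ₀ Rz Zt).εbg P.K k (domAltOfRecord F N (theta12LiveOfRecord F N ζ₀ Rz Zt).ν P.K k))
    (huniq : ∀ (P : B12.RunParams) (k : ℕ), k ≤ P.K → ∀ V ∈ domAltOfRecord F N (theta12LiveOfRecord F N ζ₀ Rz Zt).ν P.K k, ∀ j < k,
      UniqueUkOrbit F N P.K (j + 1) (theta12LiveOfRecord F N ζ₀ Rz Zt).εbg (Averaging.iter (avOfRecord F N P.K) (j + 1) (Uk F N P.K k (theta12LiveOfRecord F N ζ₀ Rz Zt).εbg V)))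
    (h10 : ∀ P : B12.RunParams, B9LeafX (Y9OfRecord N (theta12LiveOfRecord F N ζ₀ Rz Zt).toStage3Params Mstar ops) →
      (B10.Thm1PrintedCompact (((theta12LiveOfRecord F N ζ₀ Rz Zt).view₁₂B10YZW F N Mstar ops ζ lamW).res.X P).runs10 ∧
          B10.Thm2Printed (((theta12LiveOfRecord F N ζ₀ Rz Zt).view₁₂B10YZW F N Mstar ops ζ lamW).res.X P).runs10) →
        B11Leaf (Z11OfRecord F N ζ) → B12Sec2to5.Lemma4Printed ((theta12LiveOfRecord F N ζ₀ Rz Zt).res.X P).F12 ((theta12LiveOfRecord F N ζ₀ Rz Zt).res.X P).c12 →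
          B13.Lemma1Printed ((theta12LiveOfRecord F N ζ₀ Rz Zt).res.X P).S13 ((theta12LiveOfRecord F N ζ₀ Rz Zt).res.X P).c13 ∧ B13.Lemma2Printed ((theta12LiveOfRecord F N ζ₀ Rz Zt).res.X P).S13 ((theta12LiveOfRecord F N ζ₀ Rz Zt).res.X P).c13 ∧
            B13.Lemma3Printed ((theta12LiveOfRecord F N ζ₀ Rz Zt).res.X P).S13 ((theta12LiveOfRecord F N ζ₀ Rz Zt).res.X P).c13)
    (h11 : ∀ P : B12.RunParams, (leavesP w P).b7 → (leavesP w P).b8 → (leavesP w P).b9 → (leavesP w P).b10 → (leavesP w P).b11 →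
      (leavesP w P).smallCouplings → (leavesP w P).smallFieldInductive → (leavesP w P).flowControl →
        ∀ k, k < P.K → SLaw₁₂ F N (theta12LiveOfRecord F N ζ₀ Rz Zt) P k → TLaw₁₂ F N (theta12LiveOfRecord F N ζ₀ Rz Zt) P k)
    (h12 : ∀ P : B12.RunParams, B15Leaf (WOfRecord₁₂ F N (theta12LiveOfRecord F N ζ₀ Rz Zt) lamW P))
    (hUV : ∀ P : B12.RunParams, (genFlow (betaOfRecord₁₀ F N (theta12LiveOfRecord F N ζ₀ Rz Zt).toStage9Params) P.g0).InInterval w.γ P.K → ∀ k, k ≤ P.K → SLaw₁₂ F N (theta12LiveOfRecord F N ζ₀ Rz Zt) P k →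
      ∀ U : GaugeField (F.P P.K) k (SU N),
        chiFixed7 F N (theta12LiveOfRecord F N ζ₀ Rz Zt).ν P.K (gOfRecord₁₀ F N (theta12LiveOfRecord F N ζ₀ Rz Zt).toStage9Params P) k U *
              Real.exp (-(1 / (gOfRecord₁₀ F N (theta12LiveOfRecord F N ζ₀ Rz Zt).toStage9Params P k) ^ 2 * wilsonBGOfRecord F N (theta12LiveOfRecord F N ζ₀ Rz Zt).εbg P k U)
                - w.em (gOfRecord₁₀ F N (theta12LiveOfRecord F N ζ₀ Rz Zt).toStage9Params P k) * (Fintype.card (Site (F.P P.K) k) : ℝ)) ≤ densOfRecord₁₀ F N (theta12LiveOfRecord F N ζ₀ Rz Zt).toStage9Params P k U ∧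
        densOfRecord₁₀ F N (theta12LiveOfRecord F N ζ₀ Rz Zt).toStage9Params P k U ≤ Real.exp (w.ep (gOfRecord₁₀ F N (theta12LiveOfRecord F N ζ₀ Rz Zt).toStage9Params P k) * (Fintype.card (Site (F.P P.K) k) : ℝ)))
    (hlo : BetaLowerH w.b w.γ (datumOfRecord₁₂ F N (theta12LiveOfRecord F N ζ₀ Rz Zt) hP).βfun) (hhi : BetaUpperH w.βup w.γ (datumOfRecord₁₂ F N (theta12LiveOfRecord F N ζ₀ Rz Zt) hP).βfun) :
    ∃ (θ' : Stage12Params F N) (h' : θ'.Provisos₁₂ F N), (θ'.ZtUnity F N ∧ θ'.SlotsNondegenerate) ∧ θ'.Admissible F N ∧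
      B16.EndStatementBPrinted (datumOfRecord₁₂ F N θ' h').C ∧
      ∃ γ₁ : ℝ, 0 < γ₁ ∧ ∀ γ : ℝ, 0 < γ → γ ≤ γ₁ → ∃ P : B12.RunParams, 1 ≤ P.K ∧ ((datumOfRecord₁₂ F N θ' h').C P).flow.InInterval γ P.K :=
  N24_stabilityBR12e_thetaShape15_fourPin_pointed_all_liveRepin (theta12OfRecord F N ζ₀ Rz Zt) hP (admissible_theta12OfRecord F N ζ₀ Rz Zt) hZ
    (kappa_nonneg_theta12OfRecord F N ζ₀ Rz Zt) (E0_nonneg_theta12OfRecord F N ζ₀ Rz Zt) (B0_nonneg_theta12OfRecord F N ζ₀ Rz Zt)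
    Mstar ops ζ lamW w hC hγ hL hup h05 h06 h07 h08 h09 h11dom hres huniq h10 h11 h12 hUV hlo hhi

end Theta

end Literature.MathematicalPhysics.QuantumFieldTheory.Balaban1983to89.Node00

end
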